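import Summits.CriticalPhenomena.Ising3DConformalLimit.Theses.HarmonicMomentsIsotropy
import Summits.CriticalPhenomena.Ising3DConformalLimit.Theorems.MonotoneBlockingLimitsAreConformalSummit
import Summits.CriticalPhenomena.Ising3DConformalLimit.Theorems.HyperoctahedralRPLimitRotationInvariant
import Summits.CriticalPhenomena.Ising3DConformalLimit.Theorems.HyperoctahedralRPHRP2Rigidity
import Summits.CriticalPhenomena.Ising3DConformalLimit.Theorems.HarmonicMomentsIsotropyDilutionTransfer
import Summits.CriticalPhenomena.Ising3DConformalLimit.Theorems.HarmonicMomentsIsotropyHarmonicDilution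
import Summits.CriticalPhenomena.Ising3DConformalLimit.Theorems.HarmonicMomentsIsotropyTwoPointAsymptoticIsotropyOfWindow
import HarnessLib

/-!
# Off-cone certificate for crux `AngularHierarchy` (stmt-CriticalPhenomena-6031) — crux-strategist r1

Route `HarmonicMomentsIsotropy`: `closes : AngularHierarchy → CorrelationLengthWindow → RotationUpgrade →
ExistsScaleCovariantLimit → InversionUpgradeNormalised → IsingEuclidUpgradeR4NonGaussian → HarmonicDilution →
HierarchyClosure → TwoPointAsymptoticIsotropy → DilutionTransfer → Assembly → Ising3DConformalLimit`.

This file shows, over LANDED theorems only (no sorry):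

* `hmi_summit_iff_three_hubs` — the sub-problem is EXACTLY the three shared hub items of this route
  (1981 ∧ 1982 ∧ 0636), route copies included (defeq with the `HyperoctahedralRP` copies);
* `closes_without_AngularHierarchy` — `closes` re-proved from the three hubs alone: the route's own cruxes
  `AngularHierarchy` (6031), `CorrelationLengthWindow` (6032), `RotationUpgrade` (6033) and the milestones
  `HarmonicDilution` (6034), `TwoPointAsymptoticIsotropy` (6036) are NOT load-bearing for the sub-problem;
* `rotationUpgrade_now` — item 6033 is a tree theorem (nine-mirror RP rigidity 1979 + rotation upgrade 1980/8367);
* `twoPointAsymptoticIsotropy_of_hubEX` — item 6036 follows from hub item 1981 alone (landed p115280);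
* `angularHierarchy_buys` — what the crux DOES give: `HarmonicDilution` (near-critical two-point isotropy of moments,
  CPRV's `ρ > 0` in no-rate form), via the landed `hierarchyClosure_proof`; a FRONTIER milestone, not a summit input.
-/

namespace Summit.CriticalPhenomena.Ising3DConformalLimit.Cruxes.AngularHierarchy.StrategistR1

open Summit.CriticalPhenomena.Ising3DConformalLimit.Theses

/-- The sub-problem is exactly the conjunction of the three hub items — stated over THIS route's copies of the
decls (identical bodies to `HyperoctahedralRP.*`; the landed `summit_iff_three_hubs` elaborates against them by δ). -/
theorem hmi_summit_iff_three_hubs :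
    _root_.Ising3DConformalLimit ↔
      (HarmonicMomentsIsotropy.ExistsScaleCovariantLimit ∧ HarmonicMomentsIsotropy.InversionUpgradeNormalised ∧
        HarmonicMomentsIsotropy.IsingEuclidUpgradeR4NonGaussian) :=
  Theorems.LimitsAreConformalSummit.summit_iff_three_hubs

/-- **`closes` without the route's own cruxes.** -/
theorem closes_without_AngularHierarchy
    (hEX : HarmonicMomentsIsotropy.ExistsScaleCovariantLimit)
    (hINV : HarmonicMomentsIsotropy.InversionUpgradeNormalised)
    (hU4 : HarmonicMomentsIsotropy.IsingEuclidUpgradeR4NonGaussian) : _root_.Ising3DConformalLimit :=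
  hmi_summit_iff_three_hubs.2 ⟨hEX, hINV, hU4⟩

/-- Conversely each hub is necessary: the honest residual of the route IS the sub-problem. -/
theorem three_hubs_of_summit (h : _root_.Ising3DConformalLimit) :
    HarmonicMomentsIsotropy.ExistsScaleCovariantLimit ∧ HarmonicMomentsIsotropy.InversionUpgradeNormalised ∧
      HarmonicMomentsIsotropy.IsingEuclidUpgradeR4NonGaussian :=
  hmi_summit_iff_three_hubs.1 h

/-- Item 6033 `RotationUpgrade` is provable NOW: its consequent is verbatim the consequent of
`HyperoctahedralRP.LimitRotationInvariant` (item 1980, proved), whose antecedent `HRP2Rigidity` (item 1979) is proved;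
the lattice two-point-isotropy antecedent of 6033 is not used. -/
theorem rotationUpgrade_now : HarmonicMomentsIsotropy.RotationUpgrade :=
  fun _ => Cruxes.LimitRotationInvariant.QuarterTurnLiouville.limitRotationInvariant_proof
    Cruxes.HRP2Rigidity.XRayMellin.HRP2Rigidity_of

/-- Item 6036 from hub item 1981 alone (landed `twoPointAsymptoticIsotropy_of_existsScaleCovariantLimit`). -/
theorem twoPointAsymptoticIsotropy_of_hubEX (hEX : HarmonicMomentsIsotropy.ExistsScaleCovariantLimit) :
    HarmonicMomentsIsotropy.TwoPointAsymptoticIsotropy :=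
  Summit.CriticalPhenomena.Ising3DConformalLimit.HarmonicMomentsIsotropyTwoPoint.twoPointAsymptoticIsotropy_of_existsScaleCovariantLimit hEX

/-- What the crux buys: near-critical harmonic dilution (item 6034), by the landed hierarchy closure. -/
theorem angularHierarchy_buys (hAH : HarmonicMomentsIsotropy.AngularHierarchy) :
    HarmonicMomentsIsotropy.HarmonicDilution :=
  Theorems.hierarchyClosure_proof hAH

/-- The full binder list of the route's `closes`, discharged: every binder other than the three hubs is either
ignored or a tree theorem. (Same type as the route's `closes`, re-proved without touching `h_AH`, `h_CLW`.) -/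
theorem closes_residual_form :
    HarmonicMomentsIsotropy.AngularHierarchy → HarmonicMomentsIsotropy.CorrelationLengthWindow →
    HarmonicMomentsIsotropy.RotationUpgrade → HarmonicMomentsIsotropy.ExistsScaleCovariantLimit →
    HarmonicMomentsIsotropy.InversionUpgradeNormalised → HarmonicMomentsIsotropy.IsingEuclidUpgradeR4NonGaussian →
    HarmonicMomentsIsotropy.HarmonicDilution → HarmonicMomentsIsotropy.HierarchyClosure →
    HarmonicMomentsIsotropy.TwoPointAsymptoticIsotropy → HarmonicMomentsIsotropy.DilutionTransfer →
    HarmonicMomentsIsotropy.Assembly → _root_.Ising3DConformalLimit :=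
  fun _ _ _ hEX hINV hU4 _ _ _ _ _ => closes_without_AngularHierarchy hEX hINV hU4

/-- `TwoPointAsymptoticIsotropy` (item 6036) is a CONSEQUENCE of the sub-problem (S → 1981 → 6036, both landed):
the lattice two-point isotropy milestone is necessary for S, and already implied by the hub the summit needs anyway. -/
theorem twoPointAsymptoticIsotropy_of_summit (h : _root_.Ising3DConformalLimit) :
    HarmonicMomentsIsotropy.TwoPointAsymptoticIsotropy :=
  twoPointAsymptoticIsotropy_of_hubEX (hmi_summit_iff_three_hubs.1 h).1

/-- The FRONTIER ladder that IS landed around the crux (no hub item used): the route's two own cruxes give the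
lattice isotropy milestone — `AngularHierarchy → CorrelationLengthWindow → TwoPointAsymptoticIsotropy`
(`Theorems/HarmonicMomentsIsotropyTwoPointAsymptoticIsotropyOfWindow.lean`). Its ceiling (6036) is a consequence of S
(previous theorem) that no deciding theorem of the sub-problem consumes: bankable, not summit distance. -/
theorem frontier_ladder (hAH : HarmonicMomentsIsotropy.AngularHierarchy)
    (hCLW : HarmonicMomentsIsotropy.CorrelationLengthWindow) : HarmonicMomentsIsotropy.TwoPointAsymptoticIsotropy :=
  Summit.CriticalPhenomena.Ising3DConformalLimit.HarmonicMomentsIsotropyTwoPoint.twoPointAsymptoticIsotropy_of_angularHierarchy_window hAH hCLW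

#print axioms closes_without_AngularHierarchy
#print axioms twoPointAsymptoticIsotropy_of_summit
#print axioms frontier_ladder
#print axioms rotationUpgrade_now

end Summit.CriticalPhenomena.Ising3DConformalLimit.Cruxes.AngularHierarchy.StrategistR1
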